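import Summits.NavierStokesRegularity.NavierStokesRegularity.Theorems.SoloSalvageWu2026WeakProduct
import HarnessLib

/-!
# C177 `Wu2026` — Prop 3.3 toolkit (part 5): the chain rule `∇β(u) = β′(u)∇u` for `β ∈ C¹`
# with bounded derivative

D-0090 NS-CLAIMS sweep, claim C177 (W. Wu, arXiv:2608.22471v1), skeleton
`Literature/Claims/NS/Wu2026.lean`; kernel objects for the binder `hP33` of `claim_of_steps''`
(Proposition 3.3 p.20, `Step_P33`: «For every β ∈ C¹(R) with ‖β′‖_∞ < ∞ … div(β(Q)V) =
β′(Q)V·∇Q», p.20 l.23–32, l.95–100). In the vocabulary of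
`Literature.Analysis.FunctionSpaces.HasWeakFDerivOn`:

* `hasWeakFDerivOn_comp_of_deriv_bound` — `u ∈ L^p(Ω)`, `Du ∈ L^q(Ω)` weakly (`1 ≤ p, q < ∞`),
  `β ∈ C¹` with `‖β′‖_∞ ≤ L` ⟹ `β ∘ u` has the weak derivative `β′(u) Du` on `Ω` (Evans, *PDE*,
  §5.10 Problem 17; Gilbarg–Trudinger, Lemma 7.5). Proof: mollify `u` (part 2: `uₙ → u` in
  `L^p` and a.e., `Duₙ → Du` in `L^q` near the support of the test function), classical identity
  for `β ∘ uₙ`, Lipschitz bound on the left, Hölder plus dominated convergence on the right.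

Seat ns-in-wu-p33 (cell pub/ns-inputs, D-0154 (2) INPUTS). WHAT THIS IS NOT: not a claim about
NS regularity or blow-up; no summit statement is proved here.
-/

noncomputable section

set_option linter.dupNamespace false

open MeasureTheory TopologicalSpace Set Function Filter Topology Metric
open scoped ENNReal NNReal Topology ContDiff RealInnerProductSpace

namespace Summit.NavierStokesRegularity.NavierStokesRegularity.Theorems.Wu2026Salvage

open Literature.Analysis.FunctionSpaces

variable {E : Type*} [NormedAddCommGroup E] [InnerProductSpace ℝ E] [FiniteDimensional ℝ E]
  [MeasurableSpace E] [BorelSpace E] {μ : Measure E} [μ.IsAddHaarMeasure]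
variable {F : Type*} [NormedAddCommGroup F] [NormedSpace ℝ F] [CompleteSpace F]

/-! ### The chain rule `D(β ∘ u) = β'(u) Du` for `β ∈ C¹` with bounded derivative -/

section Chain

omit [BorelSpace E] [NormedSpace ℝ F] [CompleteSpace F] in
/-- Local integrability from a pointwise bound `‖g‖ ≤ C ‖f‖ + D` on an open set, `f` locally
integrable there (on compacts, constants are integrable). [folklore] -/
theorem locallyIntegrableOn_of_norm_le {U : Opens E} {f : E → F} {G : Type*}
    [NormedAddCommGroup G] {g : E → G} (hf : LocallyIntegrableOn f (U : Set E) μ)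
    (hg : AEStronglyMeasurable g (μ.restrict (U : Set E))) {C D : ℝ}
    (h : ∀ x, ‖g x‖ ≤ C * ‖f x‖ + D) : LocallyIntegrableOn g (U : Set E) μ := by
  refine (locallyIntegrableOn_iff U.isOpen.isLocallyClosed).2 fun K hKU hK => ?_
  haveI : IsFiniteMeasure (μ.restrict K) :=
    ⟨by rw [Measure.restrict_apply_univ]; exact hK.measure_lt_top⟩
  have hfK : IntegrableOn f K μ := hf.integrableOn_compact_subset hKU hK
  have hb : Integrable (fun x => C * ‖f x‖ + D) (μ.restrict K) :=
    (hfK.norm.const_mul C).add (integrable_const D)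
  exact hb.mono' (hg.mono_measure (Measure.restrict_mono hKU le_rfl)) (Eventually.of_forall h)

/-- A `C¹` function with `|β'| ≤ L` satisfies `|β a − β b| ≤ L |a − b|`. [folklore] -/
theorem abs_sub_le_of_deriv_bound {β : ℝ → ℝ} (hβ : ContDiff ℝ 1 β) {L : ℝ}
    (hL : ∀ z, ‖deriv β z‖ ≤ L) (a b : ℝ) : |β a - β b| ≤ L * |a - b| := by
  have hL0 : 0 ≤ L := (norm_nonneg _).trans (hL 0)
  have hlip : LipschitzWith (Real.toNNReal L) β :=
    lipschitzWith_of_nnnorm_deriv_le (hβ.differentiable one_ne_zero) fun x => by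
      rw [← norm_toNNReal]; exact Real.toNNReal_le_toNNReal (hL x)
  have := hlip.dist_le_mul a b
  rwa [Real.dist_eq, Real.dist_eq, Real.coe_toNNReal L hL0] at this

/-- **Chain rule for `W^{1}`-functions and `C¹` outer functions with bounded derivative**
(Evans, *PDE*, §5.10 Problem 17; Gilbarg–Trudinger, Lemma 7.5): if `u ∈ L^p(Ω)` has the weak
derivative `Du ∈ L^q(Ω)` on `Ω` (`1 ≤ p, q < ∞`) and `β ∈ C¹(ℝ)` with `‖β'‖_∞ ≤ L`, then
`β ∘ u` has the weak derivative `β'(u) Du` on `Ω`. In Prop 3.3 this is «β ∈ C¹(R) with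
‖β′‖_∞ < ∞ … ∇β(Q) = β′(Q)∇Q» (p.20 l.23–32, l.95–100). Proof: mollify `u` (part 2: `uₙ → u`
in `L^p` and a.e., `Duₙ → Du` in `L^q` on the support of the test function); for the smooth `uₙ`
the identity is classical (`HasWeakFDerivOn.of_contDiff_holds`); the left side passes to the
limit by the Lipschitz bound, the right side by Hölder plus dominated convergence for
`β′(uₙ) → β′(u)` a.e. [cite: Wu2026, Prop 3.3 p.20 l.23–32] -/
theorem hasWeakFDerivOn_comp_of_deriv_bound {Ω : Opens E} {u : E → ℝ} {gu : E → E →L[ℝ] ℝ}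
    {p q : ℝ≥0∞} (hp : 1 ≤ p) (hp' : p ≠ ⊤) (hq : 1 ≤ q) (hq' : q ≠ ⊤)
    (hu : HasWeakFDerivOn Ω μ u gu) (hup : MemLp u p (μ.restrict Ω))
    (hguq : MemLp gu q (μ.restrict Ω)) {β : ℝ → ℝ} (hβ : ContDiff ℝ 1 β) {L : ℝ}
    (hL : ∀ z, ‖deriv β z‖ ≤ L) :
    HasWeakFDerivOn Ω μ (fun x => β (u x)) (fun x => deriv β (u x) • gu x) := by
  have hL0 : 0 ≤ L := (norm_nonneg _).trans (hL 0)
  have hβd : Differentiable ℝ β := hβ.differentiable one_ne_zero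
  have hβc : Continuous β := hβ.continuous
  have hβ'c : Continuous (deriv β) := hβ.continuous_deriv le_rfl
  have hlip := abs_sub_le_of_deriv_bound hβ hL
  have hum : AEStronglyMeasurable u (μ.restrict Ω) := hup.1
  have hgum : AEStronglyMeasurable gu (μ.restrict Ω) := hguq.1
  -- growth of `β`: `|β z| ≤ L |z| + |β 0|`
  have hgrowth : ∀ z, ‖β z‖ ≤ L * ‖z‖ + ‖β 0‖ := fun z => by
    have h := hlip z 0
    rw [sub_zero] at h
    rw [Real.norm_eq_abs, Real.norm_eq_abs, Real.norm_eq_abs]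
    calc |β z| = |β z - β 0 + β 0| := by rw [sub_add_cancel]
      _ ≤ |β z - β 0| + |β 0| := abs_add_le _ _
      _ ≤ L * |z| + |β 0| := by gcongr
  refine ⟨?_, ?_, fun φ w hφ => ?_⟩
  · exact locallyIntegrableOn_of_norm_le hu.locallyIntegrableOn (hβc.comp_aestronglyMeasurable hum)
      fun x => hgrowth (u x)
  · refine locallyIntegrableOn_of_norm_le hu.locallyIntegrableOn_deriv
      ((hβ'c.comp_aestronglyMeasurable hum).smul hgum) (C := L) (D := 0) fun x => ?_
    rw [add_zero, norm_smul]
    exact mul_le_mul_of_nonneg_right (hL _) (norm_nonneg _)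
  -- the identity, by approximation
  set K : Set E := tsupport φ with hK_def
  have hK : IsCompact K := hφ.hasCompactSupport
  have hKΩ : K ⊆ (Ω : Set E) := hφ.tsupport_subset
  obtain ⟨w', hws, hwp, hwq, hae⟩ :=
    exists_smooth_approx_two_exponents hu hp hp' hq hq' hup hguq hK hKΩ
  have hφc : Continuous φ := hφ.contDiff.continuous
  have hDφc : Continuous (fderiv ℝ φ) := hφ.contDiff.continuous_fderiv (by simp)
  obtain ⟨Cφ, hCφ⟩ := hφc.bounded_above_of_compact_support hφ.hasCompactSupport
  obtain ⟨CDφ, hCDφ⟩ := hDφc.bounded_above_of_compact_support (hφ.hasCompactSupport.fderiv ℝ)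
  set ν : Measure E := μ.restrict K with hν
  haveI : IsFiniteMeasure ν := ⟨by rw [hν, Measure.restrict_apply_univ]; exact hK.measure_lt_top⟩
  have hνΩ : ν ≤ μ.restrict (Ω : Set E) := Measure.restrict_mono hKΩ le_rfl
  have hupν : MemLp u p ν := hup.mono_measure hνΩ
  have hguν : MemLp gu q ν := hguq.mono_measure hνΩ
  have humν : AEStronglyMeasurable u ν := hupν.1
  have hgumν : AEStronglyMeasurable gu ν := hguν.1
  have huint : Integrable u ν := hupν.integrable hp
  have hguint : Integrable gu ν := hguν.integrable hq
  have hwc : ∀ n, Continuous (w' n) := fun n => (hws n).continuous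
  have hwd : ∀ n, Differentiable ℝ (w' n) := fun n => (hws n).differentiable (by simp)
  have hDwc : ∀ n, Continuous (fderiv ℝ (w' n)) := fun n => (hws n).continuous_fderiv (by simp)
  have hwint : ∀ n, Integrable (w' n) ν := fun n =>
    (memLp_restrict_of_continuous_isCompact (hwc n) hK 1).integrable le_rfl
  have hDwint : ∀ n, Integrable (fderiv ℝ (w' n)) ν := fun n =>
    (memLp_restrict_of_continuous_isCompact (hDwc n) hK 1).integrable le_rfl
  have hφ0 : ∀ x, x ∉ K → φ x = 0 := fun x hx => image_eq_zero_of_notMem_tsupport hx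
  have hDφ0 : ∀ x, x ∉ K → fderiv ℝ φ x = 0 := fun x hx => fderiv_of_notMem_tsupport ℝ hx
  -- `L¹(ν)` convergence of `wₙ → u` and `Dwₙ → Du`
  have hL1w : Tendsto (fun n => eLpNorm (w' n - u) 1 ν) atTop (𝓝 0) :=
    tendsto_eLpNorm_of_tendsto_eLpNorm_of_le hp (fun n => (hwc n).aestronglyMeasurable.sub humν)
      (by simpa [Pi.sub_def] using hwp)
  have hL1Dw : Tendsto (fun n => eLpNorm (fun x => fderiv ℝ (w' n) x - gu x) 1 ν) atTop (𝓝 0) :=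
    tendsto_eLpNorm_of_tendsto_eLpNorm_of_le hq
      (fun n => (hDwc n).aestronglyMeasurable.sub hgumν) hwq
  -- Step 1: the classical identity for `β ∘ wₙ`, on `ν`
  have hstep : ∀ n, ∫ x, fderiv ℝ φ x w * β (w' n x) ∂ν =
      -∫ x, φ x * (deriv β (w' n x) * fderiv ℝ (w' n) x w) ∂ν := by
    intro n
    have hc1 : ContDiff ℝ 1 fun x => β (w' n x) :=
      hβ.comp ((hws n).of_le (by exact_mod_cast le_top))
    have h := (HasWeakFDerivOn.of_contDiff_holds Ω μ hc1).integral_fderiv_smul_eq φ w hφ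
    have hD : ∀ x, fderiv ℝ (fun x => β (w' n x)) x w = deriv β (w' n x) * fderiv ℝ (w' n) x w :=
      fun x => by
        have hfd : HasFDerivAt (fun x => β (w' n x)) (deriv β (w' n x) • fderiv ℝ (w' n) x) x :=
          (hβd (w' n x)).hasDerivAt.comp_hasFDerivAt x ((hwd n) x).hasFDerivAt
        rw [hfd.fderiv, smul_apply, smul_eq_mul]
    have hL0' : ∀ x, x ∉ K → fderiv ℝ φ x w • β (w' n x) = 0 := fun x hx => by
      rw [hDφ0 x hx, zero_apply, zero_smul]
    have hR0' : ∀ x, x ∉ K → φ x • fderiv ℝ (fun x => β (w' n x)) x w = 0 := fun x hx => by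
      rw [hφ0 x hx, zero_smul]
    rw [setIntegral_eq_setIntegral_of_forall_notMem_eq_zero hL0' hKΩ,
      setIntegral_eq_setIntegral_of_forall_notMem_eq_zero hR0' hKΩ] at h
    simpa only [smul_eq_mul, hD] using h
  -- Step 2: the left-hand sides converge (Lipschitz bound, `L¹ × L^∞` pairing)
  have hβu : Integrable (fun x => β (u x)) ν :=
    ((huint.norm.const_mul L).add (integrable_const ‖β 0‖)).mono'
      (hβc.comp_aestronglyMeasurable humν) (Eventually.of_forall fun x => hgrowth (u x))
  have hlimL : Tendsto (fun n => ∫ x, fderiv ℝ φ x w * β (w' n x) ∂ν) atTop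
      (𝓝 (∫ x, fderiv ℝ φ x w * β (u x) ∂ν)) := by
    refine tendsto_integral_of_norm_sub_le_mul (p := 1) (q := ⊤) (C := L)
      (fun n => (hDφc.clm_apply continuous_const).aestronglyMeasurable.mul
        (hβc.comp_aestronglyMeasurable (hwc n).aestronglyMeasurable))
      (hβu.bdd_mul (hDφc.clm_apply continuous_const).aestronglyMeasurable
        (c := CDφ * ‖w‖) (Eventually.of_forall fun x =>
          ((fderiv ℝ φ x).le_opNorm w).trans (mul_le_mul_of_nonneg_right (hCDφ x) (norm_nonneg _))))
      (fun n => (hwc n).aestronglyMeasurable) humν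
      (memLp_top_of_bound (hDφc.clm_apply continuous_const).aestronglyMeasurable (CDφ * ‖w‖)
        (Eventually.of_forall fun x =>
          ((fderiv ℝ φ x).le_opNorm w).trans (mul_le_mul_of_nonneg_right (hCDφ x) (norm_nonneg _))))
      (fun n x => ?_) hL1w
    rw [← mul_sub, norm_mul]
    calc ‖fderiv ℝ φ x w‖ * ‖β (w' n x) - β (u x)‖
        ≤ ‖fderiv ℝ φ x w‖ * (L * ‖w' n x - u x‖) :=
          mul_le_mul_of_nonneg_left (by rw [Real.norm_eq_abs, Real.norm_eq_abs]; exact hlip _ _)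
            (norm_nonneg _)
      _ = L * (‖w' n x - u x‖ * ‖fderiv ℝ φ x w‖) := by ring
  -- Step 3: the right-hand sides converge (Hölder for `Dwₙ → Du`, dominated convergence for
  -- `β'(wₙ) → β'(u)`)
  set T1 : ℕ → E → ℝ := fun n x =>
    φ x * (deriv β (w' n x) * (fderiv ℝ (w' n) x - gu x) w) with hT1
  set T2 : ℕ → E → ℝ := fun n x => φ x * (deriv β (w' n x) * gu x w) with hT2
  have hβ'm : ∀ n, AEStronglyMeasurable (fun x => deriv β (w' n x)) ν := fun n =>
    (hβ'c.comp (hwc n)).aestronglyMeasurable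
  have hT2m : ∀ n, AEStronglyMeasurable (T2 n) ν := fun n =>
    hφc.aestronglyMeasurable.mul ((hβ'm n).mul
      (aestronglyMeasurable_clm_apply hgumν aestronglyMeasurable_const))
  have hT1m : ∀ n, AEStronglyMeasurable (T1 n) ν := fun n =>
    hφc.aestronglyMeasurable.mul ((hβ'm n).mul
      (aestronglyMeasurable_clm_apply ((hDwc n).aestronglyMeasurable.sub hgumν)
        aestronglyMeasurable_const))
  have hT2bd : ∀ n x, ‖T2 n x‖ ≤ Cφ * L * ‖w‖ * ‖gu x‖ := fun n x => by
    rw [hT2, norm_mul, norm_mul]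
    calc ‖φ x‖ * (‖deriv β (w' n x)‖ * ‖gu x w‖) ≤ Cφ * (L * (‖gu x‖ * ‖w‖)) := by
          gcongr
          · exact (norm_nonneg _).trans (hCφ x)
          · exact hCφ x
          · exact hL _
          · exact (gu x).le_opNorm w
      _ = Cφ * L * ‖w‖ * ‖gu x‖ := by ring
  have hT2int : ∀ n, Integrable (T2 n) ν := fun n =>
    (hguint.norm.const_mul (Cφ * L * ‖w‖)).mono' (hT2m n) (Eventually.of_forall (hT2bd n))
  have hT1int : ∀ n, Integrable (T1 n) ν := fun n => by
    have hd : Integrable (fun x => fderiv ℝ (w' n) x - gu x) ν := (hDwint n).sub hguint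
    refine (hd.norm.const_mul (Cφ * L * ‖w‖)).mono' (hT1m n) (Eventually.of_forall fun x => ?_)
    rw [hT1, norm_mul, norm_mul]
    calc ‖φ x‖ * (‖deriv β (w' n x)‖ * ‖(fderiv ℝ (w' n) x - gu x) w‖)
        ≤ Cφ * (L * (‖fderiv ℝ (w' n) x - gu x‖ * ‖w‖)) := by
          gcongr
          · exact (norm_nonneg _).trans (hCφ x)
          · exact hCφ x
          · exact hL _
          · exact (fderiv ℝ (w' n) x - gu x).le_opNorm w
      _ = Cφ * L * ‖w‖ * ‖fderiv ℝ (w' n) x - gu x‖ := by ring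
  have hsplit : ∀ n, ∫ x, φ x * (deriv β (w' n x) * fderiv ℝ (w' n) x w) ∂ν =
      ∫ x, T1 n x ∂ν + ∫ x, T2 n x ∂ν := fun n => by
    rw [← integral_add (hT1int n) (hT2int n)]
    refine integral_congr_ae (Eventually.of_forall fun x => ?_)
    simp only [hT1, hT2, sub_apply]
    ring
  have hlim1 : Tendsto (fun n => ∫ x, T1 n x ∂ν) atTop (𝓝 (∫ x, (0 : ℝ) ∂ν)) := by
    refine tendsto_integral_of_norm_sub_le_mul (p := 1) (q := ⊤) (C := L * ‖w‖) hT1m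
      (integrable_zero _ _ _) (fun n => (hDwc n).aestronglyMeasurable) hgumν
      (memLp_top_of_bound hφc.aestronglyMeasurable Cφ (Eventually.of_forall hCφ))
      (fun n x => ?_) hL1Dw
    rw [sub_zero, hT1, norm_mul, norm_mul]
    calc ‖φ x‖ * (‖deriv β (w' n x)‖ * ‖(fderiv ℝ (w' n) x - gu x) w‖)
        ≤ ‖φ x‖ * (L * (‖fderiv ℝ (w' n) x - gu x‖ * ‖w‖)) := by
          gcongr
          · exact hL _
          · exact (fderiv ℝ (w' n) x - gu x).le_opNorm w
      _ = L * ‖w‖ * (‖fderiv ℝ (w' n) x - gu x‖ * ‖φ x‖) := by ring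
  have hlim2 : Tendsto (fun n => ∫ x, T2 n x ∂ν) atTop
      (𝓝 (∫ x, φ x * (deriv β (u x) * gu x w) ∂ν)) := by
    refine tendsto_integral_of_dominated_convergence (fun x => Cφ * L * ‖w‖ * ‖gu x‖) hT2m
      (hguint.norm.const_mul _) (fun n => Eventually.of_forall (hT2bd n)) ?_
    filter_upwards [hae] with x hx
    have h1 : Tendsto (fun n => deriv β (w' n x)) atTop (𝓝 (deriv β (u x))) :=
      (hβ'c.tendsto _).comp hx
    exact (h1.mul_const _).const_mul _
  have hlimR : Tendsto (fun n => ∫ x, φ x * (deriv β (w' n x) * fderiv ℝ (w' n) x w) ∂ν) atTop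
      (𝓝 (∫ x, φ x * (deriv β (u x) * gu x w) ∂ν)) := by
    have h := hlim1.add hlim2
    rw [integral_zero, zero_add] at h
    exact h.congr fun n => (hsplit n).symm
  have hEq : ∫ x, fderiv ℝ φ x w * β (u x) ∂ν = -∫ x, φ x * (deriv β (u x) * gu x w) ∂ν :=
    tendsto_nhds_unique hlimL (hlimR.neg.congr fun n => (hstep n).symm)
  -- conclusion
  have hL0' : ∀ x, x ∉ K → fderiv ℝ φ x w • β (u x) = 0 := fun x hx => by
    rw [hDφ0 x hx, zero_apply, zero_smul]
  have hR0' : ∀ x, x ∉ K → φ x • (deriv β (u x) • gu x) w = 0 := fun x hx => by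
    rw [hφ0 x hx, zero_smul]
  rw [setIntegral_eq_setIntegral_of_forall_notMem_eq_zero hL0' hKΩ,
    setIntegral_eq_setIntegral_of_forall_notMem_eq_zero hR0' hKΩ]
  simpa only [smul_eq_mul, smul_apply] using hEq

end Chain

end Summit.NavierStokesRegularity.NavierStokesRegularity.Theorems.Wu2026Salvage
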